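import Mathlib
import HarnessLib
import Summits.HubbardSuperconductivity.HubbardSuperconductivity.Theses.WeakCouplingBCS
import Literature.MathematicalPhysics.QuantumLattice.HubbardGrandCanonicalDensity
import Summits.HubbardSuperconductivity.HubbardSuperconductivity.Theorems.WeakCouplingBCSH1TwoPointLimitKLScaleDDoor
import Summits.HubbardSuperconductivity.HubbardSuperconductivity.Theorems.WeakCouplingBCSWcbcsBcsConstructionRegularEquationOfState
import Summits.HubbardSuperconductivity.HubbardSuperconductivity.Theorems.WeakCouplingBCSWcbcsBcsConstructionAeDensityConvergence
import Summits.HubbardSuperconductivity.HubbardSuperconductivity.Theorems.WeakCouplingBCSWcbcsBcsConstructionGcDensitySandwichFree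
import Summits.HubbardSuperconductivity.HubbardSuperconductivity.Theorems.WeakCouplingBCSWcbcsKohnLuttingerB1gMuWindow

/-!
# Route `WeakCouplingBCS` (ladder H3) — the TYPED crux 4 `WcbcsBcsConstruction` BY NAME from rung R2d's certificate half,
# the registered research stub (M_loc) and the no-density-jump stub (D_loc): what the typed crux costs beyond R2d

Cell `gate-hubbard-kl`, seat `hubbard-kl-h1-p1` (row «R2dH1 leaf → WeakCouplingBCS/H3 consumers»), wave 3; companion of
`…Theorems.WeakCouplingBCSH1TwoPointLimitKLScaleDDoor` (thin order / thin crux / the summit from {R2d certificate, (M_loc), crux 2})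
and `…Plumbing` / `…Fillings`.  Support file for crux 4 (stmt-HubbardSuperconductivity-2010).

The registered skeleton of crux 4 (`Cruxes/WcbcsBcsConstruction/Lines/ladder_scale_certified_chain.lean`, rev c5-2) closes the TYPED
crux — ONE doping `δ ∈ (0, 1/2)` uniform over the coupling window, a density-matched `μ(U)` and the rate `e^{-C/U²}` — from
(P1)(P2)(P3)/(Penc) [the Kohn–Luttinger level window], (M_loc) `stub_dWaveOrderFloorOnLeadingWindows`, (D_loc)
`stub_noDensityJumpOnLevelWindows` and the LANDED (Bgen) `stub_gcDensitySandwichFree`, through the equation-of-state composition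
`WcbcsBcsConstruction_of` (Darboux–Griffiths on a jump-free sub-window).  This file re-runs that composition in the Theorems tree with
the Kohn–Luttinger level window supplied by RUNG R2d's CERTIFICATE HALF instead of (Penc):

* `wcbcsBcsConstruction_of_shiftedWindowFloor_of_noDensityJump` / `wcbcsBcsConstruction_of_windowLeading_of_klMechanism_of_noDensityJump`
  — GENERIC: a level window `[μ₁, μ₂] ⊂ [-2, -3/10]` with free filling `n(μ₁) > 1/2` carrying an order floor on the shifted windows
  `[μ₁ + U/2, μ₂]` (resp. on which `B1g` leads every other `D₄` channel by `γU²` for `U < U₁`, plus (M_loc) VERBATIM), plus (D_loc)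
  VERBATIM as hypothesis (the registered signatures of stmt-2010 / stmt-1740), imply `WcbcsBcsConstruction` BY NAME.  Proof = the skeleton's
  (adapted from `Cruxes/WcbcsBcsConstruction/Lines/ladder_scale_certified_chain.lean`, `WcbcsBcsConstruction_of`, lead c5/c6): EOS
  sub-window `[m, μ₂]`, `m = (μ₁+μ₂)/2`, step `r = (μ₂-m)/6`; (D_loc) ⟹ `e(U,·)` differentiable on `[m, μ₂]`
  (`wcbcs_eos_differentiableAt_of_noDensityJump`); (Bgen) at `U ≤ r·min(F(m+2r)-F(m+r), F(μ₂-r)-F(μ₂-2r))` brackets the end densities;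
  Darboux (`exists_tendsto_gcDensity_of_regularWindow`) gives a density-matched `μ(U) ∈ [m, μ₂] ⊆ [μ₁ + U/2, μ₂]` at the `U`-uniform
  doping `δ := 1 - F(μ₂ - 2r) ∈ (0, 1/2)` (`F(μ₂) < 1` as `μ₂ < 0`; `F(m + 2r) ≥ F(μ₁) > 1/2`); (M_loc) gives the floor there.
* `wcbcsBcsConstruction_of_r2dCert_of_klMechanism_of_noDensityJump` — THE INSTANCE on the level window `[-21/50, -7/20]`: the three
  window enclosure records `klCertB1gWin{A,B,C}.EnclosuresB1g` of R2d's certificate half (form (A), VERIFIED on stmt-0158) give the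
  leading (`R2dH1.r2dCert_leading_levelWindow`), `klwL_filling_ge` gives `n(-21/50) ≥ 13/20 > 1/2`; so
  **{R2d certificate, (M_loc), (D_loc)} ⇒ the typed crux 4** — its Kohn–Luttinger input is discharged by the rung, (Bgen) is landed,
  and what remains open on H3 for the TYPED statement is exactly (M_loc) + (D_loc) (for the summit, (M_loc) + crux 2: door §2).
* `wcbcsBcsConstruction_of_klPair_of_klMechanismRel_of_noDensityJump` — the same with the leaf `H1TwoPointLimitKLScaleD` BY NAME and
  (M_loc) RELATIVISED to normal-phase control (door §3; `R2dH1.control_on_muWindow_of_fillings` + `klwL_filling_ge` / `klwU_filling_le`).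
* `hubbardSuperconductivity_of_r2dCert_of_klMechanism_of_noDensityJump_of_ssbToTorusLRO` — through the route's OWN deciding theorem
  `WeakCouplingBCS.closes` (crux 2 BY NAME + the typed crux just obtained); the door's §2 reaches the summit without (D_loc).

Sorry-free, standard axioms, no definition; hypotheses (M_loc)/(D_loc) are the registered stub signatures byte-for-byte.
Sources: T. Koma, H. Tasaki, J. Stat. Phys. 76 (1994) 745, §1; R. B. Griffiths, J. Math. Phys. 5 (1964) 1215 (density from the
derivative of the ground-state energy); S. Raghu, S. A. Kivelson, D. J. Scalapino, Phys. Rev. B 81 (2010) 224505, §III Fig. 2.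
-/

noncomputable section

-- the tree's namespace `Summit.<Summit>.<Problem>.Theorems` repeats the summit name by design (D-0017)
set_option linter.dupNamespace false

namespace Summit.HubbardSuperconductivity.HubbardSuperconductivity.Theorems.R2dH1

open Filter Set
open Literature.MathematicalPhysics.QuantumLattice Literature.Probability.LatticeModels
open Summit.HubbardSuperconductivity.HubbardSuperconductivity.Theses.WeakCouplingBCS
  (H1TwoPointLimitKLScaleD WcbcsKohnLuttingerB1g WcbcsSsbToTorusLRO WcbcsBcsConstruction)
open scoped Topology

/-- **The typed crux 4 from an order floor on the shifted level windows and (D_loc)** (generic form of the skeleton's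
`WcbcsBcsConstruction_of`, adapted from `Cruxes/WcbcsBcsConstruction/Lines/ladder_scale_certified_chain.lean`).  Let
`[μ₁, μ₂] ⊂ [-2, -3/10]` be a level window with free filling `n(μ₁) > 1/2`, carrying an order floor
`e^{-C/U²} ≤ dWaveOrderParameter U μ` for all `U ∈ (0, U₀)`, `μ ∈ [μ₁ + U/2, μ₂]` (the conclusion shape of (M_loc)
`stub_dWaveOrderFloorOnLeadingWindows` on this window).  If (D_loc) `stub_noDensityJumpOnLevelWindows` holds (its registered
signature, as hypothesis), then `WcbcsBcsConstruction`: ONE doping `δ ∈ (0, 1/2)`, a coupling window, `C > 0` and for every `U` a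
density-matched `μ(U)` with `e^{-C/U²} ≤ dWaveOrderParameter U μ(U)`.  ((Bgen) `stub_gcDensitySandwichFree` is landed.)
[cite: KomaTasaki1994, §1] -/
theorem wcbcsBcsConstruction_of_shiftedWindowFloor_of_noDensityJump {μ₁ μ₂ : ℝ}
    (hμ₁ : -2 ≤ μ₁) (h12 : μ₁ < μ₂) (hμ₂ : μ₂ ≤ -(3:ℝ) / 10)
    (hhalf : 1 / 2 < KohnLuttinger.filling (squareDispersion 1 0) μ₁)
    (hfl : ∃ U₀ C : ℝ, 0 < U₀ ∧ 0 < C ∧ ∀ U ∈ Set.Ioo (0:ℝ) U₀, ∀ μ ∈ Set.Icc (μ₁ + U / 2) μ₂,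
      Real.exp (-C / U ^ 2) ≤ dWaveOrderParameter U μ)
    (hD : ∀ μ₁ μ₂ : ℝ, -2 ≤ μ₁ → μ₁ < μ₂ → μ₂ ≤ -(3:ℝ) / 10 → ∃ U_J : ℝ, 0 < U_J ∧ ∀ U ∈ Set.Ioo (0:ℝ) U_J,
      ∀ ν ∈ Set.Icc μ₁ μ₂, ∀ ε > 0, ∃ h > 0, ∃ᶠ L : ℕ in atTop,
        ((hubbardTorusWith 2 (L + 1) 1 U (ν + h)).groundStateFunctional totalNumber).re / ((L + 1 : ℕ) : ℝ) ^ 2 -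
          ((hubbardTorusWith 2 (L + 1) 1 U (ν - h)).groundStateFunctional totalNumber).re / ((L + 1 : ℕ) : ℝ) ^ 2 ≤ ε) :
    WcbcsBcsConstruction := by
  obtain ⟨U₀, C, hU₀, hC, hM⟩ := hfl
  -- the EOS window `[m, μ₂]` and the step `r`
  set m : ℝ := (μ₁ + μ₂) / 2 with hm
  have hm₁ : μ₁ < m := by rw [hm]; linarith
  have hm₂ : m < μ₂ := by rw [hm]; linarith
  obtain ⟨U_J, hUJ, hJ⟩ := hD m μ₂ (by linarith) hm₂ hμ₂
  set r : ℝ := (μ₂ - m) / 6 with hr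
  have hrpos : 0 < r := by rw [hr]; linarith
  set F : ℝ → ℝ := KohnLuttinger.filling (squareDispersion 1 0) with hF
  -- all points used lie in `[-4, 4]`, where the free filling is strictly increasing
  have hI : ∀ x : ℝ, μ₁ ≤ x → x ≤ μ₂ → x ∈ Set.Icc (-4:ℝ) 4 := fun x h1 h2 =>
    ⟨by linarith, by linarith⟩
  have hF1 : F (m + r) < F (m + 2 * r) :=
    strictMonoOn_filling (hI _ (by linarith) (by linarith)) (hI _ (by linarith) (by linarith)) (by linarith)
  have hF2 : F (m + 2 * r) < F (μ₂ - 2 * r) :=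
    strictMonoOn_filling (hI _ (by linarith) (by linarith)) (hI _ (by linarith) (by linarith)) (by linarith)
  have hF3 : F (μ₂ - 2 * r) < F (μ₂ - r) :=
    strictMonoOn_filling (hI _ (by linarith) (by linarith)) (hI _ (by linarith) (by linarith)) (by linarith)
  have hFlo : F μ₁ ≤ F (m + 2 * r) := monotone_filling (by linarith)
  have hFhi : F (μ₂ - 2 * r) ≤ F μ₂ := monotone_filling (by linarith)
  have hFμ₂ : F μ₂ < 1 := filling_lt_one_of_neg (by linarith)
  -- the doping bracket `a < b` inside `(0, 1/2)`
  set a : ℝ := 1 - F (μ₂ - 2 * r) with ha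
  set b : ℝ := 1 - F (m + 2 * r) with hb
  have ha0 : 0 < a := by rw [ha]; linarith
  have hab : a < b := by rw [ha, hb]; linarith
  have hb2 : b < 1 / 2 := by rw [hb]; linarith
  -- the coupling threshold of the brackets
  set U_B : ℝ := r * min (F (m + 2 * r) - F (m + r)) (F (μ₂ - r) - F (μ₂ - 2 * r)) with hUB
  have hUBpos : 0 < U_B := mul_pos hrpos (lt_min (by linarith) (by linarith))
  refine ⟨a, ⟨ha0, hab.trans hb2⟩, min U₀ (min U_J (min U_B (μ₂ - μ₁))),
    lt_min hU₀ (lt_min hUJ (lt_min hUBpos (by linarith))), C, hC, fun U hU => ?_⟩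
  have hUpos : 0 < U := hU.1
  have hUU₀ : U < U₀ := lt_of_lt_of_le hU.2 (min_le_left _ _)
  have hUUJ : U < U_J := lt_of_lt_of_le hU.2 ((min_le_right _ _).trans (min_le_left _ _))
  have hUUB : U < U_B := lt_of_lt_of_le hU.2 ((min_le_right _ _).trans ((min_le_right _ _).trans (min_le_left _ _)))
  have hUw : U < μ₂ - μ₁ := lt_of_lt_of_le hU.2 ((min_le_right _ _).trans ((min_le_right _ _).trans (min_le_right _ _)))
  -- (D_loc): the limiting equation of state is differentiable on `[m, μ₂]`
  set e : ℝ → ℝ := fun y : ℝ => limUnder atTop (fun L : ℕ =>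
    (hubbardTorusWith 2 (L + 1) 1 U y).groundEnergy / ((L + 1 : ℕ) : ℝ) ^ 2) with he
  have hdiff : ∀ ν ∈ Set.Icc m μ₂, DifferentiableAt ℝ e ν := fun ν hν =>
    wcbcs_eos_differentiableAt_of_noDensityJump U ν (hJ U ⟨hUpos, hUUJ⟩ ν hν)
  have hlim : ∀ μ' : ℝ, Tendsto (fun L : ℕ => (hubbardTorusWith 2 (L + 1) 1 U μ').groundEnergy /
      ((L + 1 : ℕ) : ℝ) ^ 2) atTop (𝓝 (e μ')) := fun μ' => wcbcs_tendsto_gcEnergyDensity_limUnder U μ'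
  have hder : ∀ μ' ∈ Set.Icc m μ₂, HasDerivAt e (deriv e μ') μ' := fun μ' hμ' => (hdiff μ' hμ').hasDerivAt
  -- density limits at the two ends, bracketed by (Bgen)
  have hmI : m ∈ Set.Icc m μ₂ := ⟨le_rfl, hm₂.le⟩
  have hμ₂I : μ₂ ∈ Set.Icc m μ₂ := ⟨hm₂.le, le_rfl⟩
  have hTm := wcbcs_tendsto_gcDensity_of_differentiableAt U m (hdiff m hmI)
  have hTμ₂ := wcbcs_tendsto_gcDensity_of_differentiableAt U μ₂ (hdiff μ₂ hμ₂I)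
  obtain ⟨hBm, -⟩ := stub_gcDensitySandwichFree U m r hUpos.le hrpos
  obtain ⟨-, hBμ₂⟩ := stub_gcDensitySandwichFree U μ₂ r hUpos.le hrpos
  rw [hTm.limsup_eq] at hBm
  rw [hTμ₂.liminf_eq] at hBμ₂
  have hUr1 : U / r ≤ F (m + 2 * r) - F (m + r) := by
    rw [div_le_iff₀ hrpos]
    calc U ≤ U_B := hUUB.le
      _ ≤ r * (F (m + 2 * r) - F (m + r)) := by
          rw [hUB]; exact mul_le_mul_of_nonneg_left (min_le_left _ _) hrpos.le
      _ = (F (m + 2 * r) - F (m + r)) * r := by ring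
  have hUr2 : U / r ≤ F (μ₂ - r) - F (μ₂ - 2 * r) := by
    rw [div_le_iff₀ hrpos]
    calc U ≤ U_B := hUUB.le
      _ ≤ r * (F (μ₂ - r) - F (μ₂ - 2 * r)) := by
          rw [hUB]; exact mul_le_mul_of_nonneg_left (min_le_right _ _) hrpos.le
      _ = (F (μ₂ - r) - F (μ₂ - 2 * r)) * r := by ring
  have h₁ : -deriv e m ≤ 1 - b := by
    have : 1 - b = F (m + 2 * r) := by rw [hb]; ring
    rw [this]; linarith
  have h₂ : 1 - a ≤ -deriv e μ₂ := by
    have : 1 - a = F (μ₂ - 2 * r) := by rw [ha]; ring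
    rw [this]; linarith
  -- Darboux–Griffiths: a density-matched `μ(U) ∈ [m, μ₂]` at doping `a`
  obtain ⟨μ, hμ, hdens⟩ := exists_tendsto_gcDensity_of_regularWindow 1 U hm₂.le hlim hder h₁ h₂
    (δ := a) ⟨le_rfl, hab.le⟩
  -- (M_loc): the floor at `μ(U) ∈ [m, μ₂] ⊆ [μ₁ + U/2, μ₂]`
  have hμ' : μ ∈ Set.Icc (μ₁ + U / 2) μ₂ := ⟨by rw [hm] at hμ; linarith [hμ.1], hμ.2⟩
  exact ⟨μ, hdens, hM U ⟨hUpos, hUU₀⟩ μ hμ'⟩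

/-- **The typed crux 4 from a leading level window, (M_loc) and (D_loc).** If `B1g` leads every other `D₄` channel of the
second-order vertex by `γU²` for `U ∈ (0, U₁)` on a level window `[μ₁, μ₂] ⊂ [-2, -3/10]` with `n(μ₁) > 1/2`, then (M_loc) and (D_loc)
(registered signatures of stmt-2010 / stmt-1740, as hypotheses) give `WcbcsBcsConstruction`. [cite: KomaTasaki1994, §1] -/
theorem wcbcsBcsConstruction_of_windowLeading_of_klMechanism_of_noDensityJump {μ₁ μ₂ γ U₁ : ℝ}
    (hμ₁ : -2 ≤ μ₁) (h12 : μ₁ < μ₂) (hμ₂ : μ₂ ≤ -(3:ℝ) / 10) (hγ : 0 < γ) (hU₁ : 0 < U₁)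
    (hhalf : 1 / 2 < KohnLuttinger.filling (squareDispersion 1 0) μ₁)
    (hK : ∀ U ∈ Set.Ioo (0:ℝ) U₁, ∀ μ ∈ Set.Icc μ₁ μ₂, ∀ χ : D4Irrep, χ ≠ D4Irrep.B1g →
      channelInf (squareDispersion 1 0) μ U D4Irrep.B1g + γ * U ^ 2 ≤ channelInf (squareDispersion 1 0) μ U χ)
    (hM : ∀ μ₁ μ₂ γ U₁ : ℝ, -2 ≤ μ₁ → μ₁ < μ₂ → μ₂ ≤ -(3:ℝ) / 10 → 0 < γ → 0 < U₁ →
      (∀ U ∈ Set.Ioo (0:ℝ) U₁, ∀ μ ∈ Set.Icc μ₁ μ₂, ∀ χ : D4Irrep, χ ≠ D4Irrep.B1g →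
        channelInf (squareDispersion 1 0) μ U D4Irrep.B1g + γ * U ^ 2 ≤ channelInf (squareDispersion 1 0) μ U χ) →
      ∃ U₀ C : ℝ, 0 < U₀ ∧ 0 < C ∧ ∀ U ∈ Set.Ioo (0:ℝ) U₀, ∀ μ ∈ Set.Icc (μ₁ + U / 2) μ₂,
        Real.exp (-C / U ^ 2) ≤ dWaveOrderParameter U μ)
    (hD : ∀ μ₁ μ₂ : ℝ, -2 ≤ μ₁ → μ₁ < μ₂ → μ₂ ≤ -(3:ℝ) / 10 → ∃ U_J : ℝ, 0 < U_J ∧ ∀ U ∈ Set.Ioo (0:ℝ) U_J,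
      ∀ ν ∈ Set.Icc μ₁ μ₂, ∀ ε > 0, ∃ h > 0, ∃ᶠ L : ℕ in atTop,
        ((hubbardTorusWith 2 (L + 1) 1 U (ν + h)).groundStateFunctional totalNumber).re / ((L + 1 : ℕ) : ℝ) ^ 2 -
          ((hubbardTorusWith 2 (L + 1) 1 U (ν - h)).groundStateFunctional totalNumber).re / ((L + 1 : ℕ) : ℝ) ^ 2 ≤ ε) :
    WcbcsBcsConstruction :=
  wcbcsBcsConstruction_of_shiftedWindowFloor_of_noDensityJump hμ₁ h12 hμ₂ hhalf (hM μ₁ μ₂ γ U₁ hμ₁ h12 hμ₂ hγ hU₁ hK) hD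

/-- **THE TYPED CRUX 4 FROM RUNG R2d's CERTIFICATE HALF, (M_loc) AND (D_loc).** The three referee-replayed window enclosure records
of R2d's certificate half (cert form (A), VERIFIED on stmt-0158) supply the leading level window `[-21/50, -7/20]`
(`r2dCert_leading_levelWindow`; `n(-21/50) ≥ 13/20 > 1/2` by `klwL_filling_ge`); with crux 4's registered research stub (M_loc)
`stub_dWaveOrderFloorOnLeadingWindows` and its no-density-jump stub (D_loc) `stub_noDensityJumpOnLevelWindows` VERBATIM as
hypotheses, `WcbcsBcsConstruction` follows BY NAME.  On ladder H3: the typed crux's Kohn–Luttinger input is discharged by the rung's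
certificate; its open content is (M_loc) + (D_loc). [cite: KomaTasaki1994, §1] -/
theorem wcbcsBcsConstruction_of_r2dCert_of_klMechanism_of_noDensityJump (hA : klCertB1gWinA.EnclosuresB1g)
    (hB : klCertB1gWinB.EnclosuresB1g) (hC : klCertB1gWinC.EnclosuresB1g)
    (hM : ∀ μ₁ μ₂ γ U₁ : ℝ, -2 ≤ μ₁ → μ₁ < μ₂ → μ₂ ≤ -(3:ℝ) / 10 → 0 < γ → 0 < U₁ →
      (∀ U ∈ Set.Ioo (0:ℝ) U₁, ∀ μ ∈ Set.Icc μ₁ μ₂, ∀ χ : D4Irrep, χ ≠ D4Irrep.B1g →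
        channelInf (squareDispersion 1 0) μ U D4Irrep.B1g + γ * U ^ 2 ≤ channelInf (squareDispersion 1 0) μ U χ) →
      ∃ U₀ C : ℝ, 0 < U₀ ∧ 0 < C ∧ ∀ U ∈ Set.Ioo (0:ℝ) U₀, ∀ μ ∈ Set.Icc (μ₁ + U / 2) μ₂,
        Real.exp (-C / U ^ 2) ≤ dWaveOrderParameter U μ)
    (hD : ∀ μ₁ μ₂ : ℝ, -2 ≤ μ₁ → μ₁ < μ₂ → μ₂ ≤ -(3:ℝ) / 10 → ∃ U_J : ℝ, 0 < U_J ∧ ∀ U ∈ Set.Ioo (0:ℝ) U_J,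
      ∀ ν ∈ Set.Icc μ₁ μ₂, ∀ ε > 0, ∃ h > 0, ∃ᶠ L : ℕ in atTop,
        ((hubbardTorusWith 2 (L + 1) 1 U (ν + h)).groundStateFunctional totalNumber).re / ((L + 1 : ℕ) : ℝ) ^ 2 -
          ((hubbardTorusWith 2 (L + 1) 1 U (ν - h)).groundStateFunctional totalNumber).re / ((L + 1 : ℕ) : ℝ) ^ 2 ≤ ε) :
    WcbcsBcsConstruction := by
  obtain ⟨γ, hγ, hlead⟩ := r2dCert_leading_levelWindow hA hB hC
  have hlead' : ∀ U ∈ Set.Ioo (0:ℝ) 1, ∀ μ ∈ Set.Icc (-(21:ℝ) / 50) (-(7:ℝ) / 20), ∀ χ : D4Irrep,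
      χ ≠ D4Irrep.B1g → channelInf (squareDispersion 1 0) μ U D4Irrep.B1g + γ * U ^ 2 ≤
        channelInf (squareDispersion 1 0) μ U χ :=
    fun U hU μ hμ χ hχ => hlead U hU μ ⟨le_trans (by norm_num) hμ.1, hμ.2⟩ χ hχ
  have hhalf : 1 / 2 < KohnLuttinger.filling (squareDispersion 1 0) (-(21:ℝ) / 50) :=
    lt_of_lt_of_le (by norm_num) klwL_filling_ge
  exact wcbcsBcsConstruction_of_windowLeading_of_klMechanism_of_noDensityJump (by norm_num) (by norm_num) (by norm_num)
    hγ one_pos hhalf hlead' hM hD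

/-- **The typed crux 4 from the KL PAIR, the RELATIVISED stub and (D_loc).** The leaf `H1TwoPointLimitKLScaleD` BY NAME, transported
to the level window `[-21/50, -7/20]` (`R2dH1.control_on_muWindow_of_fillings`, certified fillings `klwL_filling_ge`,
`klwU_filling_le`), discharges the added antecedent of «(M_loc | normal-phase control)» (door §3); with the certificate half and
(D_loc) the typed crux follows.  Every binder is load-bearing. [cite: KomaTasaki1994, §1] -/
theorem wcbcsBcsConstruction_of_klPair_of_klMechanismRel_of_noDensityJump (hleaf : H1TwoPointLimitKLScaleD)
    (hA : klCertB1gWinA.EnclosuresB1g) (hB : klCertB1gWinB.EnclosuresB1g) (hC : klCertB1gWinC.EnclosuresB1g)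
    (hBr : ∀ μ₁ μ₂ γ U₁ U₀ c : ℝ, -2 ≤ μ₁ → μ₁ < μ₂ → μ₂ ≤ -(3:ℝ) / 10 → 0 < γ → 0 < U₁ → 0 < U₀ → 0 < c →
      (∀ μ ∈ Set.Icc μ₁ μ₂, ∀ U β : ℝ, 0 < U → U ≤ U₀ → 0 < β → β ≤ Real.exp (c / U ^ 2) →
        ∀ (x y : Site 2) (σ σ' : Fin 2), ∃ S : ℂ,
          Tendsto (fun L : ℕ => hubbardThermalTwoPoint β U μ L x y σ σ') atTop (𝓝 S)) →
      (∀ U ∈ Set.Ioo (0:ℝ) U₁, ∀ μ ∈ Set.Icc μ₁ μ₂, ∀ χ : D4Irrep, χ ≠ D4Irrep.B1g →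
        channelInf (squareDispersion 1 0) μ U D4Irrep.B1g + γ * U ^ 2 ≤ channelInf (squareDispersion 1 0) μ U χ) →
      ∃ U₀' C : ℝ, 0 < U₀' ∧ 0 < C ∧ ∀ U ∈ Set.Ioo (0:ℝ) U₀', ∀ μ ∈ Set.Icc (μ₁ + U / 2) μ₂,
        Real.exp (-C / U ^ 2) ≤ dWaveOrderParameter U μ)
    (hD : ∀ μ₁ μ₂ : ℝ, -2 ≤ μ₁ → μ₁ < μ₂ → μ₂ ≤ -(3:ℝ) / 10 → ∃ U_J : ℝ, 0 < U_J ∧ ∀ U ∈ Set.Ioo (0:ℝ) U_J,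
      ∀ ν ∈ Set.Icc μ₁ μ₂, ∀ ε > 0, ∃ h > 0, ∃ᶠ L : ℕ in atTop,
        ((hubbardTorusWith 2 (L + 1) 1 U (ν + h)).groundStateFunctional totalNumber).re / ((L + 1 : ℕ) : ℝ) ^ 2 -
          ((hubbardTorusWith 2 (L + 1) 1 U (ν - h)).groundStateFunctional totalNumber).re / ((L + 1 : ℕ) : ℝ) ^ 2 ≤ ε) :
    WcbcsBcsConstruction := by
  -- stage 1 (the leaf), transported to the level window `[-21/50, -7/20]`
  obtain ⟨U₀, c, hU₀, hc, hctl⟩ :=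
    control_on_muWindow_of_fillings hleaf (μ₁ := -(21:ℝ) / 50) (μ₂ := -(7:ℝ) / 20) (by norm_num) (by norm_num)
      klwL_filling_ge klwU_filling_le
  -- the certificate half on the same window
  obtain ⟨γ, hγ, hlead⟩ := r2dCert_leading_levelWindow hA hB hC
  have hlead' : ∀ U ∈ Set.Ioo (0:ℝ) 1, ∀ μ ∈ Set.Icc (-(21:ℝ) / 50) (-(7:ℝ) / 20), ∀ χ : D4Irrep,
      χ ≠ D4Irrep.B1g → channelInf (squareDispersion 1 0) μ U D4Irrep.B1g + γ * U ^ 2 ≤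
        channelInf (squareDispersion 1 0) μ U χ :=
    fun U hU μ hμ χ hχ => hlead U hU μ ⟨le_trans (by norm_num) hμ.1, hμ.2⟩ χ hχ
  have hhalf : 1 / 2 < KohnLuttinger.filling (squareDispersion 1 0) (-(21:ℝ) / 50) :=
    lt_of_lt_of_le (by norm_num) klwL_filling_ge
  -- stage 2 given stage 1: the floor on the shifted windows `[-21/50 + U/2, -7/20]`
  have hfl := hBr (-(21:ℝ) / 50) (-(7:ℝ) / 20) γ 1 U₀ c (by norm_num) (by norm_num) (by norm_num) hγ one_pos hU₀ hc
    hctl hlead'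
  exact wcbcsBcsConstruction_of_shiftedWindowFloor_of_noDensityJump (by norm_num) (by norm_num) (by norm_num) hhalf hfl hD

/-- **The summit through the route's own deciding theorem.** Crux 2 `WcbcsSsbToTorusLRO` BY NAME and the typed crux 4 obtained from
{R2d certificate, (M_loc), (D_loc)} give `HubbardSuperconductivity` via `WeakCouplingBCS.closes` (the door's §2 reaches the summit
WITHOUT (D_loc), through thin order; this is the typed-crux route for comparison). [cite: KomaTasaki1994, §1] -/
theorem hubbardSuperconductivity_of_r2dCert_of_klMechanism_of_noDensityJump_of_ssbToTorusLRO
    (hA : klCertB1gWinA.EnclosuresB1g) (hB : klCertB1gWinB.EnclosuresB1g) (hC : klCertB1gWinC.EnclosuresB1g)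
    (hM : ∀ μ₁ μ₂ γ U₁ : ℝ, -2 ≤ μ₁ → μ₁ < μ₂ → μ₂ ≤ -(3:ℝ) / 10 → 0 < γ → 0 < U₁ →
      (∀ U ∈ Set.Ioo (0:ℝ) U₁, ∀ μ ∈ Set.Icc μ₁ μ₂, ∀ χ : D4Irrep, χ ≠ D4Irrep.B1g →
        channelInf (squareDispersion 1 0) μ U D4Irrep.B1g + γ * U ^ 2 ≤ channelInf (squareDispersion 1 0) μ U χ) →
      ∃ U₀ C : ℝ, 0 < U₀ ∧ 0 < C ∧ ∀ U ∈ Set.Ioo (0:ℝ) U₀, ∀ μ ∈ Set.Icc (μ₁ + U / 2) μ₂,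
        Real.exp (-C / U ^ 2) ≤ dWaveOrderParameter U μ)
    (hD : ∀ μ₁ μ₂ : ℝ, -2 ≤ μ₁ → μ₁ < μ₂ → μ₂ ≤ -(3:ℝ) / 10 → ∃ U_J : ℝ, 0 < U_J ∧ ∀ U ∈ Set.Ioo (0:ℝ) U_J,
      ∀ ν ∈ Set.Icc μ₁ μ₂, ∀ ε > 0, ∃ h > 0, ∃ᶠ L : ℕ in atTop,
        ((hubbardTorusWith 2 (L + 1) 1 U (ν + h)).groundStateFunctional totalNumber).re / ((L + 1 : ℕ) : ℝ) ^ 2 -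
          ((hubbardTorusWith 2 (L + 1) 1 U (ν - h)).groundStateFunctional totalNumber).re / ((L + 1 : ℕ) : ℝ) ^ 2 ≤ ε)
    (h2 : WcbcsSsbToTorusLRO) : _root_.HubbardSuperconductivity :=
  Summit.HubbardSuperconductivity.HubbardSuperconductivity.Theses.WeakCouplingBCS.closes h2
    (wcbcsBcsConstruction_of_r2dCert_of_klMechanism_of_noDensityJump hA hB hC hM hD)

end Summit.HubbardSuperconductivity.HubbardSuperconductivity.Theorems.R2dH1

end
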